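import Summits.PneNP.PneNP.Theorems.NegLimitedCliqueSlices
import Summits.PneNP.PneNP.Theorems.NegLimitedDoorOfPlantedClique

/-!
# Route NegLimited — door stub 4 `QuartCliqueSlicesNP` (line `correlation-door`, stmt-PneNP-19860)

Registered stub `stub_quartCliqueSlicesNP` of the skeleton `correlation-door` on the door item
`NegLimited.NeglimitedEpsLogNegationsR` (rung F-N1/p3, ROUND-8 §B; statement `QuartCliqueSlicesNP`
declared verbatim in `NegLimitedDoorOfPlantedClique.lean`): ONE `NP` language whose slice at every
square length `m²` (`m ≥ 16`) is monotone and carries every negation-limited lower bound proved for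
`CLIQUE(m, ⌊m^{1/4}⌋) = cliqueFn m ⌊√⌊√m⌋⌋`.

The slice plumbing of `NegLimitedCliqueSlices.lean` (the `⌊√m⌋`-clique language) with the clique size
`⌊√⌊√m⌋⌋`: the verifier is `Literature.Computability.Complexity.CliqueVerifier.verFn` with its count
test re-targeted (`vK4 = isqrt ∘ isqrt`, `cntOK4`, `verFn4`; the edge test `edgesOK` and the popcount
`popFn` are the upstream bricks, whose `FP` and value lemmas are re-derived here because upstream keeps
them `private`), the language `quartCliqueLang ∈ NP` by the certificate definition, its slice at `m²`
is `cliqueFn m ⌊√⌊√m⌋⌋ ∘ edgeVec` (`sliceFn_quartCliqueLang`, via the public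
`NegLimSlices.cliqueFn_edgeVec_iff`), and lower bounds transfer along the upper-triangle retraction
(`NegLimSlices.le_negLimitedSizeOver_of_retract`).

References: S. Arora, B. Barak, *Computational Complexity* (2009), §1.3, §2.1 Ex. 2.2
[AroraBarakCC2009]; B. Rossman, *Correlation bounds against monotone NC¹*, CCC 2015, §1 (the
`⌊m^{1/4}⌋`-clique slice of the door) [Rossman2015].
-/

set_option linter.dupNamespace false

noncomputable section

namespace Summit.PneNP.PneNP.Theorems.NegLimitedDoor

open Literature.Computability.Complexity Literature.Computability.Complexity.Brick
  Literature.Computability.Complexity.CliqueVerifier Literature.Barriers.PneNP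
  Summit.PneNP.PneNP.Theorems.NegLimSlices _root_.Computability Polynomial Filter Finset

namespace QuartCliqueVerifier

/-! ## The quart-clique verifier -/

/-- **Acceptance test**: the first `m` bits of the certificate mark exactly `⌊√⌊√m⌋⌋` vertices,
every two of which are joined in the upper triangle of `u`. [cite: AroraBarak2009, §2.1 Ex. 2.2] -/
def accepts4 (u y : List Bool) (m : ℕ) : Bool :=
  decide ((y.take m).count true = Nat.sqrt (Nat.sqrt m)) &&
    decide (∀ t, t < m * m → t / m < t % m → (y.take m).getD (t / m) false = true →
      (y.take m).getD (t % m) false = true → u.getD t false = true)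

/-- Unfolding the acceptance test. [cite: AroraBarak2009, §2.1 Ex. 2.2] -/
theorem accepts4_eq_true_iff {u y : List Bool} {m : ℕ} :
    accepts4 u y m = true ↔ (y.take m).count true = Nat.sqrt (Nat.sqrt m) ∧
      ∀ t, t < m * m → t / m < t % m → (y.take m).getD (t / m) false = true →
        (y.take m).getD (t % m) false = true → u.getD t false = true := by
  simp only [accepts4, Bool.and_eq_true, decide_eq_true_iff]

/-- The clique size `1ᵏ`, `k = ⌊√⌊√m⌋⌋` (ruler `1ᵐ`). [folklore] -/
def vK4 : List Bool → List Bool := binToUnaryFn ∘ fanoutFn vM (isqrtFn ∘ vK)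

/-- The count test `[#ones of y' = ⌊√⌊√m⌋⌋]`. [folklore] -/
def cntOK4 : List Bool → List Bool := eqPairFn ∘ fanoutFn popFn vK4

/-- **The quart-clique verifier**: re-targeted count test and the upstream edge test.
[cite: AroraBarak2009, §2.1 Ex. 2.2] -/
def verFn4 : List Bool → List Bool := andFn cntOK4 edgesOK

/-! ### Polynomial time -/

/-- `bitTest p s ∈ FP` for `p, s ∈ FP`. [cite: AroraBarakCC2009, §1.3] -/
private theorem q_bitTest_mem_FP {p s : List Bool → List Bool} (hp : p ∈ FP) (hs : s ∈ FP) :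
    bitTest p s ∈ FP :=
  comp_mem_FP eqPairFn_mem_FP
    (fanoutFn_mem_FP (comp_mem_FP bitAtFn_mem_FP (fanoutFn_mem_FP hp hs)) (const_mem_FP _))

/-- The upstream bricks are in `FP`: side, clique size, truncated certificate, popcount, edge test.
[cite: AroraBarakCC2009, §1.3 (bounded loops)] -/
theorem parts_mem_FP : vM ∈ FP ∧ vK ∈ FP ∧ vY' ∈ FP ∧ popFn ∈ FP ∧ edgesOK ∈ FP := by
  have hU : vU ∈ FP := fstF_mem_FP
  have hM : vM ∈ FP :=
    comp_mem_FP binToUnaryFn_mem_FP (fanoutFn_mem_FP hU (comp_mem_FP isqrtFn_mem_FP hU))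
  have hK : vK ∈ FP :=
    comp_mem_FP binToUnaryFn_mem_FP (fanoutFn_mem_FP hM (comp_mem_FP isqrtFn_mem_FP hM))
  have hY' : vY' ∈ FP := comp_mem_FP Plumb.takeFn_mem_FP (fanoutFn_mem_FP hM sndF_mem_FP)
  have hpop : popFn ∈ FP :=
    comp_mem_FP (foldCat_mem_FP 1 X (iteFn_mem_FP (q_bitTest_mem_FP sndF_mem_FP fstF_mem_FP)
      (const_mem_FP _) (const_mem_FP _))) (fanoutFn_mem_FP hY' hY')
  have hRM : rM ∈ FP := comp_mem_FP fstF_mem_FP (comp_mem_FP sndF_mem_FP fstF_mem_FP)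
  have hRY : rY ∈ FP := comp_mem_FP sndF_mem_FP (comp_mem_FP sndF_mem_FP fstF_mem_FP)
  have hRU : rU ∈ FP := comp_mem_FP fstF_mem_FP fstF_mem_FP
  have hRAB : rAB ∈ FP := comp_mem_FP Plumb.divModFn_mem_FP (fanoutFn_mem_FP hRM sndF_mem_FP)
  have hRA : rA ∈ FP := comp_mem_FP fstF_mem_FP hRAB
  have hRB : rB ∈ FP := comp_mem_FP sndF_mem_FP hRAB
  have hviol : rViol ∈ FP :=
    andFn_mem_FP (q_bitTest_mem_FP hRA hRB) (andFn_mem_FP (q_bitTest_mem_FP hRA hRY)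
      (andFn_mem_FP (q_bitTest_mem_FP hRB hRY) (notFn_mem_FP (q_bitTest_mem_FP sndF_mem_FP hRU))))
  have hvf : violFn ∈ FP :=
    comp_mem_FP (foldCat_mem_FP 1 X (iteFn_mem_FP hviol (const_mem_FP _) (const_mem_FP _)))
      (fanoutFn_mem_FP (fanoutFn_mem_FP hU (fanoutFn_mem_FP hM hY')) hU)
  exact ⟨hM, hK, hY', hpop, comp_mem_FP eqPairFn_mem_FP (fanoutFn_mem_FP hvf (const_mem_FP _))⟩

/-- **`verFn4 ∈ FP`.** [cite: AroraBarakCC2009, §1.3 (bounded loops)] -/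
theorem verFn4_mem_FP : verFn4 ∈ FP := by
  obtain ⟨hM, hK, -, hpop, hedges⟩ := parts_mem_FP
  have hK4 : vK4 ∈ FP :=
    comp_mem_FP binToUnaryFn_mem_FP (fanoutFn_mem_FP hM (comp_mem_FP isqrtFn_mem_FP hK))
  exact andFn_mem_FP (comp_mem_FP eqPairFn_mem_FP (fanoutFn_mem_FP hpop hK4)) hedges

/-! ### Semantics -/

/-- Value of `bitTest`: `[s.getD |p| false]`. [folklore] -/
private theorem q_bitTest_apply (p s : List Bool → List Bool) (z : List Bool) :
    bitTest p s z = [(s z).getD (p z).length false] := by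
  simp only [bitTest, Function.comp_apply, fanoutFn_apply, bitAtFn_boolPair, eqPairFn_boolPair]
  congr 1
  rw [Bool.eq_iff_iff, decide_eq_true_iff]
  by_cases h : (p z).length < (s z).length
  · rw [List.take_one_drop_eq_of_lt_length h, List.getD_eq_getElem _ _ h]
    simp
  · rw [List.drop_eq_nil_of_le (by omega), List.getD_eq_default _ _ (by omega)]
    simp

/-- A bit of `1ᵇ` at `a`: `[a < b]`. [folklore] -/
private theorem q_getD_ones (a b : ℕ) : (ones b).getD a false = decide (a < b) := by
  by_cases h : a < b
  · rw [List.getD_eq_getElem _ _ (by simpa [ones] using h)]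
    simp [ones, h]
  · rw [List.getD_eq_default _ _ (by simpa [ones] using h)]
    simp [h]

/-- Values of the upstream bricks on a square matrix (`|u| = m²`): side `1ᵐ`, clique size
`1^{⌊√m⌋}`, truncated certificate `y ↾ m`. [folklore] -/
theorem parts_sq {u y : List Bool} {m : ℕ} (hu : u.length = m * m) :
    vM (boolPair u y) = ones m ∧ vK (boolPair u y) = ones (Nat.sqrt m) ∧
      vY' (boolPair u y) = y.take m := by
  have hM : vM (boolPair u y) = ones m := by
    simp only [vM, vU, Function.comp_apply, fanoutFn_apply, fstF_boolPair, isqrtFn_apply,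
      binToUnaryFn_boolPair, bitsToNat_encodeNat, hu, Nat.sqrt_eq, min_eq_left (Nat.le_mul_self m)]
  refine ⟨hM, ?_, ?_⟩
  · simp only [vK, Function.comp_apply, fanoutFn_apply, hM, isqrtFn_apply, binToUnaryFn_boolPair,
      bitsToNat_encodeNat]
    simp [ones, min_eq_left (Nat.sqrt_le_self m)]
  · simp only [vY', vY, Function.comp_apply, fanoutFn_apply, hM, sndF_boolPair, Plumb.takeFn_boolPair]
    simp [ones]

/-- The quart clique size: `vK4 ⟨u, y⟩ = 1^{⌊√⌊√m⌋⌋}` for `|u| = m²`. [folklore] -/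
theorem vK4_sq {u y : List Bool} {m : ℕ} (hu : u.length = m * m) :
    vK4 (boolPair u y) = ones (Nat.sqrt (Nat.sqrt m)) := by
  obtain ⟨hM, hK, -⟩ := parts_sq (y := y) hu
  simp only [vK4, Function.comp_apply, fanoutFn_apply, hM, hK, isqrtFn_apply, binToUnaryFn_boolPair,
    bitsToNat_encodeNat]
  simp [ones, min_eq_left ((Nat.sqrt_le_self _).trans (Nat.sqrt_le_self m))]

/-- The popcount concatenation of a list is `1^{count}`. [folklore] -/
private theorem q_ccat_pop : ∀ (l : List Bool),
    ccat (fun t => if l.getD t false = true then [true] else []) l.length = ones (l.count true) := by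
  intro l
  induction l using List.reverseRecOn with
  | nil => simp [ones]
  | append_singleton l b ih =>
    rw [List.length_append, List.length_singleton, ccat_succ]
    have h1 : ccat (fun t => if (l ++ [b]).getD t false = true then [true] else []) l.length =
        ccat (fun t => if l.getD t false = true then [true] else []) l.length :=
      ccat_congr fun t ht => by rw [List.getD_append _ _ _ _ ht]
    rw [h1, ih, List.getD_append_right _ _ _ _ le_rfl, Nat.sub_self, List.getD_cons_zero,
      List.count_append, List.count_singleton']
    cases b <;> simp [ones, List.replicate_add]

/-- **Value of the popcount fold** on a square matrix: `popFn ⟨u, y⟩ = 1^{#ones of y ↾ m}`.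
[folklore] -/
theorem popFn_sq4 {u y : List Bool} {m : ℕ} (hu : u.length = m * m) :
    popFn (boolPair u y) = ones ((y.take m).count true) := by
  obtain ⟨-, -, hY'⟩ := parts_sq (y := y) hu
  have hpiece : ∀ (y' : List Bool) (t : ℕ),
      popPiece (boolPair y' (ones t)) = if y'.getD t false = true then [true] else [] := by
    intro y' t
    have h := q_bitTest_apply sndF fstF (boolPair y' (ones t))
    simp only [sndF_boolPair, fstF_boolPair] at h
    rw [popPiece, iteFn_apply h]
    simp [ones]
  rw [popFn, Function.comp_apply, fanoutFn_apply, hY', foldCat_apply]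
  · rw [← q_ccat_pop]
    exact ccat_congr fun t _ => hpiece _ t
  · simp only [eval_X]; exact le_rfl
  · intro t _
    rw [hpiece]
    split_ifs <;> simp

/-- **Value of the re-targeted count test.** [folklore] -/
theorem cntOK4_sq {u y : List Bool} {m : ℕ} (hu : u.length = m * m) :
    cntOK4 (boolPair u y) = [decide ((y.take m).count true = Nat.sqrt (Nat.sqrt m))] := by
  simp only [cntOK4, Function.comp_apply, fanoutFn_apply, popFn_sq4 hu, vK4_sq hu, eqPairFn_boolPair]
  congr 1
  rw [Bool.eq_iff_iff, decide_eq_true_iff, decide_eq_true_iff]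
  constructor
  · intro h; simpa [ones] using congrArg List.length h
  · intro h; rw [h]

/-- The violation test at position `t` (Boolean). [folklore] -/
private def viol4 (u y' : List Bool) (m t : ℕ) : Bool :=
  decide (t / m < t % m) && (y'.getD (t / m) false && (y'.getD (t % m) false && !(u.getD t false)))

/-- **Value of the violation piece** on the record `⟨⟨u, ⟨1ᵐ, y'⟩⟩, 1ᵗ⟩`. [folklore] -/
private theorem q_violPiece_rec (u y' : List Bool) (m t : ℕ) :
    violPiece (boolPair (boolPair u (boolPair (ones m) y')) (ones t)) =
      if viol4 u y' m t then [true] else [] := by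
  set r := boolPair (boolPair u (boolPair (ones m) y')) (ones t) with hr
  have hRU : rU r = u := by simp [rU, hr]
  have hRY : rY r = y' := by simp [rY, hr]
  have hRT : rT r = ones t := by simp [rT, hr]
  have hRAB : rAB r = boolPair (ones (t / m)) (ones (t % m)) := by
    simp only [rAB, rM, rT, Function.comp_apply, fanoutFn_apply, hr, fstF_boolPair, sndF_boolPair]
    exact Plumb.divModFn_boolPair m t
  have hRA : rA r = ones (t / m) := by simp [rA, hRAB]
  have hRB : rB r = ones (t % m) := by simp [rB, hRAB]
  have hlt := q_bitTest_apply rA rB r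
  have hya := q_bitTest_apply rA rY r
  have hyb := q_bitTest_apply rB rY r
  have hut := q_bitTest_apply rT rU r
  simp only [hRA, hRB, hRY, hRT, hRU, q_getD_ones] at hlt hya hyb hut
  simp only [ones, List.length_replicate] at hlt hya hyb hut
  rw [violPiece, iteFn_apply (b := viol4 u y' m t)]
  rw [rViol, andFn_apply hlt (andFn_apply hya (andFn_apply hyb (notFn_apply hut))), viol4]

/-- A concatenation of `1`/`ε` pieces is empty iff no piece fires. [folklore] -/
private theorem q_ccat_ite_eq_nil_iff {P : ℕ → Prop} [DecidablePred P] : ∀ {k : ℕ},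
    ccat (fun t => if P t then [true] else []) k = [] ↔ ∀ t, t < k → ¬ P t
  | 0 => by simp
  | k + 1 => by
    rw [ccat_succ, List.append_eq_nil_iff, q_ccat_ite_eq_nil_iff]
    constructor
    · rintro ⟨h, h'⟩ t ht
      rcases Nat.lt_succ_iff_lt_or_eq.1 ht with ht | rfl
      · exact h t ht
      · intro hP; simp [hP] at h'
    · intro h
      exact ⟨fun t ht => h t (by omega), by simp [h k (by omega)]⟩

/-- **Value of the edge test** on a square matrix: `[no violated pair]`. [folklore] -/
theorem edgesOK_sq4 {u y : List Bool} {m : ℕ} (hu : u.length = m * m) :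
    edgesOK (boolPair u y) = [decide (∀ t, t < m * m → t / m < t % m →
      (y.take m).getD (t / m) false = true → (y.take m).getD (t % m) false = true →
        u.getD t false = true)] := by
  obtain ⟨hM, -, hY'⟩ := parts_sq (y := y) hu
  have hx : fanoutFn (fanoutFn vU (fanoutFn vM vY')) vU (boolPair u y) =
      boolPair (boolPair u (boolPair (ones m) (y.take m))) u := by
    simp only [fanoutFn_apply, vU, fstF_boolPair, hM, hY']
  have hnil : violFn (boolPair u y) = [] ↔ ∀ t, t < m * m → ¬ viol4 u (y.take m) m t = true := by
    rw [violFn, Function.comp_apply, hx, foldCat_apply, hu]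
    · rw [← q_ccat_ite_eq_nil_iff (P := fun t => viol4 u (y.take m) m t = true)]
      exact Iff.of_eq (congrArg (· = []) (ccat_congr fun t _ => by rw [q_violPiece_rec]))
    · simp only [eval_X, length_boolPair]; omega
    · intro t _
      rw [q_violPiece_rec]
      split_ifs <;> simp
  simp only [edgesOK, Function.comp_apply, fanoutFn_apply, eqPairFn_boolPair]
  rw [List.singleton_inj, Bool.eq_iff_iff, decide_eq_true_iff, decide_eq_true_iff, hnil]
  refine forall_congr' fun t => forall_congr' fun ht => ?_
  simp only [viol4, Bool.and_eq_true, decide_eq_true_iff, Bool.not_eq_true', not_and,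
    Bool.not_eq_false]

/-- **The quart-clique verifier on a square matrix**: `verFn4 ⟨u, y⟩ = [accepts4 u y m]` for
`|u| = m²`. [cite: AroraBarak2009, §2.1 Ex. 2.2] -/
theorem verFn4_sq {u y : List Bool} {m : ℕ} (hu : u.length = m * m) :
    verFn4 (boolPair u y) = [accepts4 u y m] := by
  rw [verFn4, andFn_apply (cntOK4_sq hu) (edgesOK_sq4 hu), accepts4]

end QuartCliqueVerifier

open QuartCliqueVerifier

/-! ## The language, its membership in `NP`, its slices -/

/-- The verifier language `{z | verFn4 z = 1}`. [folklore] -/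
def quartVerLang : Language Bool := {z | verFn4 z = [true]}

/-- Membership in the verifier language. [folklore] -/
theorem mem_quartVerLang {z : List Bool} : z ∈ quartVerLang ↔ verFn4 z = [true] := Iff.rfl

/-- The verifier language is in `P`. [cite: AroraBarakCC2009, Thm. 2.8] -/
theorem quartVerLang_mem_P : quartVerLang ∈ Classes.P :=
  setOf_apply_eq_apply_mem_P verFn4_mem_FP (const_mem_FP [true])

/-- **The `⌊m^{1/4}⌋`-clique language**: strings `u` with a certificate `y`, `|y| ≤ |u|`, accepted
by the quart-clique verifier. [cite: AroraBarak2009, §2.1 Ex. 2.2] -/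
def quartCliqueLang : Language Bool :=
  {u | ∃ y : List Bool, y.length ≤ (X : Polynomial ℕ).eval u.length ∧ boolPair u y ∈ quartVerLang}

/-- **`quartCliqueLang ∈ NP`** (certificate definition). [cite: AroraBarak2009, Def. 2.1] -/
theorem quartCliqueLang_mem_NP : quartCliqueLang ∈ Nondeterministic.NP :=
  mem_NP_iff_verifier.2 ⟨quartVerLang, quartVerLang_mem_P, X, fun _ => Iff.rfl⟩

variable {m : ℕ}

/-- **Slices of the quart-clique language at square lengths, in matrix coordinates** (`1 ≤ m`).
[cite: AroraBarak2009, §2.1 Ex. 2.2] -/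
theorem sliceFn_quartCliqueLang_eq_true_iff (hm : 1 ≤ m) (w : Fin (m * m) → Bool) :
    quartCliqueLang.sliceFn (m * m) w = true ↔ ∃ S : Finset (Fin m),
      S.card = Nat.sqrt (Nat.sqrt m) ∧ ∀ a ∈ S, ∀ b ∈ S, a < b →
        ∀ h : (b : ℕ) + m * (a : ℕ) < m * m, w ⟨(b : ℕ) + m * (a : ℕ), h⟩ = true := by
  have hm0 : 0 < m := hm
  have hu : (List.ofFn w).length = m * m := by simp
  have hdiv : ∀ a b : ℕ, b < m → (b + m * a) / m = a := fun a b hb => by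
    rw [Nat.add_mul_div_left _ _ hm0, Nat.div_eq_of_lt hb, zero_add]
  have hmod : ∀ a b : ℕ, b < m → (b + m * a) % m = b := fun a b hb => by
    rw [Nat.add_mul_mod_self_left, Nat.mod_eq_of_lt hb]
  show quartCliqueLang.boolIndicator (List.ofFn w) = true ↔ _
  rw [← Set.mem_iff_boolIndicator, quartCliqueLang, Set.mem_setOf_eq]
  simp only [mem_quartVerLang, verFn4_sq hu, List.cons.injEq, and_true, eval_X, hu,
    accepts4_eq_true_iff]
  constructor
  · rintro ⟨y, -, hcnt, hedge⟩
    refine ⟨Finset.univ.filter fun a : Fin m => (y.take m).getD a false = true, ?_, ?_⟩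
    · rw [card_filter_univ_fin m fun i => (y.take m).getD i false = true,
        card_filter_range_getD _ (by simp), hcnt]
    · intro a ha b hb hab h
      simp only [Finset.mem_filter, Finset.mem_univ, true_and] at ha hb
      have hab' : (a : ℕ) < b := hab
      have h1 := hedge _ h
      rw [hdiv _ _ b.2, hmod _ _ b.2] at h1
      rw [← Kannan.getD_ofFn w h]
      exact h1 hab' ha hb
  · rintro ⟨S, hcard, hcl⟩
    set y : List Bool := List.ofFn fun a : Fin m => decide (a ∈ S) with hy
    have hylen : y.length = m := by simp [hy]
    have hty : y.take m = y := List.take_of_length_le hylen.le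
    have hyget : ∀ a : Fin m, y.getD a false = decide (a ∈ S) := fun a => by
      rw [hy, Kannan.getD_ofFn _ a.2]
    refine ⟨y, by rw [hylen]; exact Nat.le_mul_self m, ?_, ?_⟩
    · rw [hty, ← card_filter_range_getD y hylen.le,
        ← card_filter_univ_fin m fun i => y.getD i false = true, ← hcard]
      congr 1
      ext a
      simp only [Finset.mem_filter, Finset.mem_univ, true_and, hyget a, decide_eq_true_iff]
    · intro t ht hab hya hyb
      rw [hty] at hya hyb
      have hbm : t % m < m := Nat.mod_lt _ hm0
      have ham : t / m < m := Nat.div_lt_of_lt_mul ht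
      have ha : (⟨t / m, ham⟩ : Fin m) ∈ S := by
        have h := hyget ⟨t / m, ham⟩
        rwa [h, decide_eq_true_iff] at hya
      have hb : (⟨t % m, hbm⟩ : Fin m) ∈ S := by
        have h := hyget ⟨t % m, hbm⟩
        rwa [h, decide_eq_true_iff] at hyb
      have hw := hcl _ ha _ hb hab (by rw [Nat.mod_add_div]; exact ht)
      rw [Kannan.getD_ofFn w ht, ← hw]
      congr 1
      apply Fin.ext
      exact (Nat.mod_add_div t m).symm

/-- **The slice of the quart-clique language at length `m²` is `CLIQUE(m, ⌊√⌊√m⌋⌋)` of the edge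
vector** (`1 ≤ m`). [cite: AroraBarak2009, §2.1 Ex. 2.2] -/
theorem sliceFn_quartCliqueLang (hm : 1 ≤ m) (w : Fin (m * m) → Bool) :
    quartCliqueLang.sliceFn (m * m) w = cliqueFn m (Nat.sqrt (Nat.sqrt m)) (edgeVec w) := by
  rw [Bool.eq_iff_iff, sliceFn_quartCliqueLang_eq_true_iff hm, cliqueFn_edgeVec_iff]

/-- The slices of the quart-clique language at square lengths are monotone (`1 ≤ m`). [folklore] -/
theorem monotone_sliceFn_quartCliqueLang (hm : 1 ≤ m) :
    Monotone (quartCliqueLang.sliceFn (m * m)) := by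
  intro x y hxy
  rw [sliceFn_quartCliqueLang hm, sliceFn_quartCliqueLang hm]
  exact (cliqueFn_monotone_holds m _) fun e => hxy (edgePos e)

/-- **The transfer package at a square length for the quart-clique witness** (`m ≥ 16`, so that
`⌊√⌊√m⌋⌋ ≥ 2`): a lower bound `s` for every De Morgan circuit with `≤ b` NOT gates computing
`CLIQUE(m, ⌊√⌊√m⌋⌋)` gives `s ≤ negLimitedSizeOver deMorganBasis b (L_{m²})`. [folklore] -/
theorem le_negLimitedSizeOver_sliceFn_quartClique (hm : 16 ≤ m) {b s : ℕ}
    (hlow : ∀ D : Circuit (KEdge m), D.IsOver deMorganBasis →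
      D.Computes (cliqueFn m (Nat.sqrt (Nat.sqrt m))) → D.negationCount ≤ b → s ≤ D.size) :
    s ≤ negLimitedSizeOver deMorganBasis b (quartCliqueLang.sliceFn (m * m)) := by
  have hk4 : 4 ≤ Nat.sqrt m := Nat.le_sqrt'.2 (by omega)
  have hk : 2 ≤ Nat.sqrt (Nat.sqrt m) := Nat.le_sqrt'.2 (by omega)
  have hTcl : CliqueLike (univ : Finset (Fin m)) (Nat.sqrt (Nat.sqrt m) - 1) (Nat.sqrt (Nat.sqrt m))
      (cliqueFn m (Nat.sqrt (Nat.sqrt m))) := cliqueLike_cliqueFn (m := m) (by omega)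
  have e₀ : KEdge m := ⟨s(⟨0, by omega⟩, ⟨1, by omega⟩), by simp [Fin.ext_iff]⟩
  refine le_negLimitedSizeOver_of_retract (g := cliqueFn m (Nat.sqrt (Nat.sqrt m))) (edgeOfPos e₀)
    (fun y => ?_) ?_ hlow
  · rw [sliceFn_quartCliqueLang (by omega), edgeVec_comp_edgeOfPos]
  · obtain ⟨C₀, hB₀, hC₀⟩ := exists_monotone_circuit_of_cliqueLike hTcl (by omega)
      ((Nat.sqrt_le_self _).trans (Nat.sqrt_le_self m))
    refine ⟨C₀.mapInputs edgePos, (hB₀.mapInputs _).mono monotoneBasis_subset_deMorgan, ?_,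
      fun x => ?_⟩
    · rw [negationCount_mapInputs, Circuit.negationCount_eq_zero_of_isOver_monotoneBasis hB₀]
      exact Nat.zero_le _
    · rw [Circuit.eval_mapInputs, hC₀, sliceFn_quartCliqueLang (by omega)]
      rfl

/-- **Registered stub `stub_quartCliqueSlicesNP` of line `correlation-door`** (door item
stmt-PneNP-19860): the quart-clique language is in `NP`, its slices at square lengths `m²`
(`m ≥ 16`) are monotone, and every negation-limited lower bound for `CLIQUE(m, ⌊√⌊√m⌋⌋)` is one for
the slice. [cite: AroraBarak2009, §2.1 Ex. 2.2] -/
theorem stub_quartCliqueSlicesNP : QuartCliqueSlicesNP :=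
  ⟨quartCliqueLang, quartCliqueLang_mem_NP, fun _ hm =>
    ⟨monotone_sliceFn_quartCliqueLang (by omega), fun _ _ hlow =>
      le_negLimitedSizeOver_sliceFn_quartClique hm hlow⟩⟩

end Summit.PneNP.PneNP.Theorems.NegLimitedDoor

end
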